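import Summits.QuantumFields.YangMills.Theorems.PencilRigidityHypercubicLimitDefs
import Summits.QuantumFields.YangMills.Theorems.PencilRigidityHypercubicLimitDefsB
import Summits.QuantumFields.YangMills.Theorems.PencilRigidityHypercubicLimitCondMeanLocality
import Summits.QuantumFields.YangMills.Theorems.PencilRigidityHypercubicLimitTelescoping
import Summits.QuantumFields.YangMills.Theorems.PencilRigidityHypercubicLimitUniformBound
import Summits.QuantumFields.YangMills.Theorems.PencilRigidityHypercubicLimitSoftLegsU
import Summits.QuantumFields.YangMills.Theorems.MirrorModularBoostsHypercubicLimitPeelReflectionLegs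
import Summits.QuantumFields.YangMills.Theorems.MirrorModularBoostsHypercubicLimitPeelOfLineInputs
import Summits.QuantumFields.YangMills.Theorems.CoincidenceRotationBootstrapHypercubicLimitOneFieldWeak
import Summits.QuantumFields.YangMills.Theorems.MirrorModularBoostsHypercubicLimitOfWeakCoupling
import HarnessLib

/-!
# Crux `HypercubicLimit` (stmt-QuantumFields-8646), line `conditional-mean-telescoping`: the four sockets close the crux AND its weak-coupling twin

Support file (`--supports stmt-QuantumFields-8646`, c6 lead seat, reshape 5).  Two things are recorded here, kernel-checked:

* `gaussianDomination_of_window` — the last piece of NON-stub proof content of the registered skeleton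
  (`Cruxes/HypercubicLimit/Lines/conditional_mean_telescoping.lean`, reshape 4): the landed lever (T) telescoping bound + (M)
  antitonicity of the influence profile (`stub_telescoping stub_condMeanLocality`, p74162/p76246) together with the two halves
  of the influence window (WI₂) `CornerFreeInfluence` and (WIₙ) `InfluenceReverseHolder` give `GaussianDomination` (chain, factor
  by factor: `|⟨∏ δp⟩| ≤ ∏ Iₙ(R) ≤ ∏ Iₙ(R') ≤ ∏ C n^γ I₂(R') ≤ ∏ C n^γ C' √A(R')`).  After this file the skeleton is pure
  composition over its four sockets.
* `weakCouplingHypercubicLimit_of_sockets` / `hypercubicLimit_of_sockets` — the SAME four sockets (L′) `LatticeGapInput`, (WI)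
  `CornerFreeInfluence ∧ InfluenceReverseHolder`, (W2) `WindowRegularity`, (NG) `NonGaussianFloor` close the STRONGER weak-coupling
  twin `CoincidenceRotationBootstrap.HypercubicLimit` (item stmt-QuantumFields-16154): the closure's scheme is built in units
  `a = m(β_k)` with `β_k → ∞`, which IS `sch.HasWeakCouplingLimit` (landed `oneFieldLimitWeak_of_legsP` + `hypercubicLimit_iff_oneFieldWeak`,
  with (U) `stub_uniformBound` p133385, (S) `stub_softLegsU` p133612, (R) `reflectionLegsP_holds` p144898); item 8646's decl
  `MirrorModularBoosts.HypercubicLimit` follows by forgetting that conjunct (`hypercubicLimit_of_coincidenceRotationBootstrap`,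
  p147954).  So this line of 8646 is verbatim a line of 16154, and its open residue is exactly 16154's.

Refs: skeleton reshape 4 (c5), `Theorems/PencilRigidityHypercubicLimitDefs.lean` §§2–5, LEAD-REPORT-c5.
-/

set_option autoImplicit false

noncomputable section

open scoped ENNReal
open MeasureTheory Filter Topology
open Literature.MathematicalPhysics.AQFT Literature.MathematicalPhysics.QuantumLattice
open Literature.MathematicalPhysics.QuantumFieldTheory
open Literature.Probability.LatticeModels (box Site)
open Summit.QuantumFields.YangMills.Theorems.HypercubicLimit.Negative (torusPlaquette rpSquare influence)

namespace Summit.QuantumFields.YangMills.Cruxes.HypercubicLimit.ConditionalMeanTelescoping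

/-- The influence profile is non-negative (it is the real part of an `Lᵖ` norm). [folklore] -/
theorem influenceProfile_nonneg {G : Type} [Group G] [TopologicalSpace G] [IsTopologicalGroup G]
    [CompactSpace G] [MeasurableSpace G] [BorelSpace G] (r : LatticeRep G) (β : ℝ) (S R : ℕ)
    (x : Site 4) (i j : Fin 4) (p : ℝ≥0∞) : 0 ≤ influence r β S R x i j p :=
  ENNReal.toReal_nonneg

/-- **(T)+(M)+(WI₂)+(WIₙ) ⇒ Gaussian domination of separated moments** (the skeleton's glue, now a tree theorem).
For plaquettes pairwise more than `2R+1` apart and a window radius `1 ≤ R' ≤ min (R, c₀/m(β))`: the torus `n`-point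
function of the centred plaquettes is at most `(C n^γ √A(R'))ⁿ`.  Chain, factor by factor: (T) the landed telescoping bound
at radius `R`, (M) the landed antitonicity `Iₙ(R) ≤ Iₙ(R')`, (WIₙ) `Iₙ(R') ≤ C n^γ I₂(R')`, (WI₂) `I₂(R') ≤ C' √A(R')`. [folklore] -/
theorem gaussianDomination_of_window :
    CornerFreeInfluence → InfluenceReverseHolder → GaussianDomination := by
  intro h₂ hₙ G _ _ _ _ _ _ hG r β₁ C₁ c₂ m hgap c₀ hc₀
  obtain ⟨C₂, β₂, h₂'⟩ := h₂ G hG r β₁ C₁ c₂ m hgap c₀ hc₀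
  obtain ⟨Cₙ, βₙ, γ, hₙ'⟩ := hₙ G hG r β₁ C₁ c₂ m hgap c₀ hc₀
  refine ⟨max Cₙ 0 * max C₂ 0, max β₂ βₙ, γ, fun β hβ n hn => ?_⟩
  obtain ⟨S₂, hS₂⟩ := h₂' β (le_trans (le_max_left _ _) hβ)
  obtain ⟨Sₙ, hSₙ⟩ := hₙ' β (le_trans (le_max_right _ _) hβ) n hn
  refine ⟨max S₂ Sₙ, fun S hS R R' o x ho hR' hR'R hR'c hfit hsep => ?_⟩
  have hS₂' : S₂ ≤ S := le_trans (le_max_left _ _) hS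
  have hSₙ' : Sₙ ≤ S := le_trans (le_max_right _ _) hS
  -- (T): the landed telescoping bound, product of `Lⁿ` influences at radius `R`
  have step1 :
      |∫ U, ∏ k, (torusPlaquette r (2 * S + 1) (o k).1 (o k).2 (x k) U -
          ∫ V, torusPlaquette r (2 * S + 1) (o k).1 (o k).2 (x k) V
            ∂(wilsonMeasure r.ρ β : Measure (GaugeConfig 4 (2 * S + 1) G)))
          ∂(wilsonMeasure r.ρ β : Measure (GaugeConfig 4 (2 * S + 1) G))|
        ≤ ∏ k, influence r β S R (x k) (o k).1 (o k).2 n :=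
    (stub_telescoping stub_condMeanLocality).1 G r β S R n o x ho hfit hsep
  -- (M): the landed antitonicity of the influence profile in the cube radius
  have antitone : ∀ (y : Site 4) (i j : Fin 4) (p : ℝ≥0∞), 1 ≤ p → ∀ R R' : ℕ, R' ≤ R →
      2 * R + 2 < 2 * S + 1 → influence r β S R y i j p ≤ influence r β S R' y i j p :=
    fun y i j p hp R R' hRR' hfit' =>
      (stub_telescoping stub_condMeanLocality).2 G r β S y i j p hp R R' hRR' hfit'
  have hp : (1 : ℝ≥0∞) ≤ (n : ℝ≥0∞) := by exact_mod_cast (le_trans (by norm_num) hn : 1 ≤ n)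
  have hfitR : 2 * R + 2 < 2 * S + 1 := by omega
  have hfactor : ∀ k : Fin n,
      influence r β S R (x k) (o k).1 (o k).2 n ≤
        max Cₙ 0 * max C₂ 0 * (n : ℝ) ^ γ * Real.sqrt (rpSquare r β S R') := by
    intro k
    have hij : (o k).1 ≠ (o k).2 := ho k
    have a1 : influence r β S R (x k) (o k).1 (o k).2 n ≤
        influence r β S R' (x k) (o k).1 (o k).2 n :=
      antitone (x k) (o k).1 (o k).2 n hp R R' hR'R hfitR
    have a2 : influence r β S R' (x k) (o k).1 (o k).2 n ≤
        Cₙ * (n : ℝ) ^ γ * influence r β S R' (x k) (o k).1 (o k).2 2 :=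
      hSₙ S hSₙ' R' hR' hR'c (x k) (o k).1 (o k).2 hij
    have a3 : influence r β S R' (x k) (o k).1 (o k).2 2 ≤ C₂ * Real.sqrt (rpSquare r β S R') :=
      hS₂ S hS₂' R' hR' hR'c (x k) (o k).1 (o k).2 hij
    have hI2 : 0 ≤ influence r β S R' (x k) (o k).1 (o k).2 2 := influenceProfile_nonneg _ _ _ _ _ _ _ _
    have hsq : 0 ≤ Real.sqrt (rpSquare r β S R') := Real.sqrt_nonneg _
    have hnγ : 0 ≤ (n : ℝ) ^ γ := by positivity
    have a2' : influence r β S R' (x k) (o k).1 (o k).2 n ≤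
        max Cₙ 0 * (n : ℝ) ^ γ * influence r β S R' (x k) (o k).1 (o k).2 2 := by
      refine le_trans a2 ?_
      have : Cₙ * (n : ℝ) ^ γ ≤ max Cₙ 0 * (n : ℝ) ^ γ :=
        mul_le_mul_of_nonneg_right (le_max_left _ _) hnγ
      exact mul_le_mul_of_nonneg_right this hI2
    have a3' : influence r β S R' (x k) (o k).1 (o k).2 2 ≤
        max C₂ 0 * Real.sqrt (rpSquare r β S R') := by
      refine le_trans a3 ?_
      exact mul_le_mul_of_nonneg_right (le_max_left _ _) hsq
    have hC : 0 ≤ max Cₙ 0 * (n : ℝ) ^ γ := mul_nonneg (le_max_right _ _) hnγ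
    calc influence r β S R (x k) (o k).1 (o k).2 n
        ≤ influence r β S R' (x k) (o k).1 (o k).2 n := a1
      _ ≤ max Cₙ 0 * (n : ℝ) ^ γ * influence r β S R' (x k) (o k).1 (o k).2 2 := a2'
      _ ≤ max Cₙ 0 * (n : ℝ) ^ γ * (max C₂ 0 * Real.sqrt (rpSquare r β S R')) :=
          mul_le_mul_of_nonneg_left a3' hC
      _ = max Cₙ 0 * max C₂ 0 * (n : ℝ) ^ γ * Real.sqrt (rpSquare r β S R') := by ring
  have step2 : ∏ k : Fin n, influence r β S R (x k) (o k).1 (o k).2 n ≤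
      ∏ _k : Fin n, (max Cₙ 0 * max C₂ 0 * (n : ℝ) ^ γ * Real.sqrt (rpSquare r β S R')) :=
    Finset.prod_le_prod (fun k _ => influenceProfile_nonneg _ _ _ _ _ _ _ _) (fun k _ => hfactor k)
  rw [Finset.prod_const, Finset.card_univ, Fintype.card_fin] at step2
  exact le_trans step1 step2

/-- **The four sockets close the weak-coupling twin (item stmt-QuantumFields-16154) BY NAME.**  (L′) lattice gap input,
(WI₂)+(WIₙ) the influence window, (W2) window regularity, (NG) the `κ₃` floor ⇒ `CoincidenceRotationBootstrap.HypercubicLimit`: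
Gaussian domination (`gaussianDomination_of_window`) ⇒ (U) the uniform bound (`stub_uniformBound`) ⇒ (S) the soft legs on the
`PolyRenorm` interface (`stub_softLegsU`), whose scheme has `β_k → ∞`; with (R) `reflectionLegsP_holds` the landed
`oneFieldLimitWeak_of_legsP` gives the one-field weak-coupling witness and `hypercubicLimit_iff_oneFieldWeak` re-labels it. [folklore] -/
theorem weakCouplingHypercubicLimit_of_sockets :
    LatticeGapInput → CornerFreeInfluence → InfluenceReverseHolder → WindowRegularity → NonGaussianFloor →
      Summit.QuantumFields.YangMills.Theses.CoincidenceRotationBootstrap.HypercubicLimit := by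
  intro hL h₂ hₙ hW hNG
  have hU : UniformBound := stub_uniformBound (gaussianDomination_of_window h₂ hₙ) hW
  have hS : SoftLegsP := stub_softLegsU hU hW hNG
  refine Summit.QuantumFields.YangMills.Theorems.HypercubicLimit.OneFieldWeak.hypercubicLimit_iff_oneFieldWeak.mpr
    fun G _ _ _ _ hG => ?_
  letI : MeasurableSpace G := borel G
  haveI : BorelSpace G := ⟨rfl⟩
  exact PeelAndDisseminate.oneFieldLimitWeak_of_legsP hL hS PeelAndDisseminate.reflectionLegsP_holds G hG

/-- **The four sockets close the crux `MirrorModularBoosts.HypercubicLimit` (item stmt-QuantumFields-8646) BY NAME** — through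
the twin: `weakCouplingHypercubicLimit_of_sockets`, then forget `sch.HasWeakCouplingLimit`
(`hypercubicLimit_of_coincidenceRotationBootstrap`).  This is the whole registered skeleton in one implication; its hypotheses
are verbatim the four registered stubs `stub_latticeGapInput`, `stub_influenceWindow.1/.2`, `stub_windowRegularity`,
`stub_nonGaussianFloor`. [folklore] -/
theorem hypercubicLimit_of_sockets :
    LatticeGapInput → CornerFreeInfluence → InfluenceReverseHolder → WindowRegularity → NonGaussianFloor →
      Summit.QuantumFields.YangMills.Theses.MirrorModularBoosts.HypercubicLimit :=
  fun hL h₂ hₙ hW hNG =>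
    Summit.QuantumFields.YangMills.Theorems.HypercubicLimit.hypercubicLimit_of_coincidenceRotationBootstrap
      (weakCouplingHypercubicLimit_of_sockets hL h₂ hₙ hW hNG)

end Summit.QuantumFields.YangMills.Cruxes.HypercubicLimit.ConditionalMeanTelescoping

end
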